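import Summits.RiemannHypothesis.RiemannHypothesis.Theorems.WeilColumnAutocorrMollLimit
import Summits.RiemannHypothesis.RiemannHypothesis.Theorems.WeilColumnYoungMollDeriv
import Summits.RiemannHypothesis.RiemannHypothesis.Theorems.WeilColumnOddMollifier
import Summits.RiemannHypothesis.RiemannHypothesis.Theorems.WeilColumnThetaArch
import Summits.RiemannHypothesis.RiemannHypothesis.Theorems.WeilColumnThetaWitness
import Literature.NumberTheory.LFunctions.WeilSemilocalNegative
import HarnessLib

/-!
# THETA certificate, tier 2 — E6/E7: the mollifier enters the prime term only through a LIMIT (RH-FREE)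

Cell `rh-explicit`, WEIL column, seat cc-s2-3 gen23 (TIER2-SOUNDNESS-PLAN v1.1 §2 E6/E7 / §6; cc-s2-1 gen22 TIER2-KERNEL-SPEC §5).
Tier 1 (`WeilColumnThetaUCCheb.re_weilQuadratic_moll_oddTail_le_of_ge`) pushes the EXPONENTIAL tail envelope `E·e^{κ(u−x₁)}`
through the mollifier `moll k` by monotonicity (`E ↦ E·e^{2κ/(k+1)}`, `x₁ ↦ x₁ + 1/(k+1)`). The tier-2 envelope is CELLWISE (not
monotone), so instead the kernel's prime-side bound is applied ONCE to the unmollified odd tail `f` (continuous, compact support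
— no `IsWeilTest` needed for the prime term, whose sum is finite) and transported to `f ⋆ moll_k` by continuity:

* §1 `weilConv_weilReflect_eq_zero_of_radius`: `(f ⋆ f̃)(t) = 0` for `|t| > 2S` when `f` vanishes beyond `S` (no smoothness);
* §2 **`tendsto_weilPrimeTerm_autocorr_moll`**: `weilPrimeTerm ((f⋆moll_k) ⋆ (f⋆moll_k)~) → weilPrimeTerm (f ⋆ f̃)` (`f ∈ C_c`;
  finite prime sum on a `k`-uniform range + handoff-prove-2's pointwise `tendsto_weilConv_weilReflect_moll`);
* §3 **`eventually_re_weilQuadratic_moll_le`** (GENERIC level-`k` Step 5′): for ODD `f ∈ C¹_c` with `‖f‖₂² ≤ A′`, `‖f′‖₂² ≤ B′`,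
  `0 < t₀ ≤ 1`, `e > 0`: eventually in `k`,
  `Re Q(f ⋆ moll_k) ≤ ‖weilPrimeTerm (f ⋆ f̃)‖ + e + (B′/2·e^{t₀/2}t₀²/2 + A′·(2·Jexplicit t₀ − log 4π − γ − archC₁)₊)`
  (D5 polar `≤ 0` by oddness, D7 arch by `ThetaArch.re_weilArchTerm_weilConv_weilReflect_le_thetaCheck` + the mollifier's `L²`
  contractions, prime by §2);
* §4 `eventually_le_of_R_steps`: the order-of-limits combinator for the tier-2 assembly (`R` fixed first, then `k → ∞`).

Upper-clause bookkeeping only; nothing here bears on the truth of RH.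
-/

noncomputable section

set_option linter.dupNamespace false

open Complex Set MeasureTheory Filter
open scoped Real Topology ComplexConjugate

namespace Summit.RiemannHypothesis.RiemannHypothesis.Theorems.WeilColumn.ThetaMellin

open Literature.NumberTheory.LFunctions Literature.NumberTheory.LFunctions.WeilContinuous ThetaParams

variable {f : ℝ → ℂ}

/-! ## §1 Support of the autocorrelation without smoothness -/

/-- If `f` vanishes for `|u| > S` then its autocorrelation `f ⋆ f̃` vanishes for `|t| > 2S` (pointwise: in
`∫ f(u)·conj f(u − t) du` one of `|u|`, `|u − t|` exceeds `S`). No continuity or measurability of `f` is used. [folklore] -/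
theorem weilConv_weilReflect_eq_zero_of_radius {S : ℝ} (hf : ∀ u : ℝ, S < |u| → f u = 0) {t : ℝ}
    (ht : 2 * S < |t|) : weilConv f (weilReflect f) t = 0 := by
  rw [weilConv_apply]
  refine integral_eq_zero_of_ae (Eventually.of_forall fun u ↦ ?_)
  simp only [weilReflect, Pi.zero_apply]
  by_cases hu : S < |u|
  · rw [hf u hu, zero_mul]
  · have h1 : |t| - |u| ≤ |t - u| := abs_sub_abs_le_abs_sub t u
    have hu' : |u| ≤ S := not_lt.1 hu
    have h2 : S < |-(t - u)| := by
      rw [abs_neg]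
      linarith
    rw [hf _ h2, map_zero, mul_zero]

/-! ## §2 E6: the prime term of the mollified autocorrelation converges -/

/-- **E6.** For `f` continuous of compact support, `weilPrimeTerm ((f ⋆ moll_k) ⋆ (f ⋆ moll_k)~) → weilPrimeTerm (f ⋆ f̃)`
as `k → ∞`: both prime sums are the SAME finite sum (`n < ⌈e^{2(R+1)+1}⌉`, `R` a support radius of `f`), and each kernel value
converges (`tendsto_weilConv_weilReflect_moll`). [folklore; TIER2-SOUNDNESS-PLAN §2 E6] -/
theorem tendsto_weilPrimeTerm_autocorr_moll (hfc : Continuous f) (hfs : HasCompactSupport f) :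
    Tendsto (fun k : ℕ ↦ weilPrimeTerm (weilConv (weilConv f (moll k)) (weilReflect (weilConv f (moll k))))) atTop
      (𝓝 (weilPrimeTerm (weilConv f (weilReflect f)))) := by
  obtain ⟨R, -, hR⟩ := exists_support_radius hfs
  have hfk : ∀ k : ℕ, ∀ u : ℝ, R + 1 < |u| → weilConv f (moll k) u = 0 := fun k u hu ↦
    weilConv_moll_eq_zero hR hu k
  have hf' : ∀ u : ℝ, R + 1 < |u| → f u = 0 := fun u hu ↦ hR u (by linarith)
  have hK : ∀ u : ℝ, 2 * (R + 1) < |u| → weilConv f (weilReflect f) u = 0 := fun u hu ↦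
    weilConv_weilReflect_eq_zero_of_radius hf' hu
  have hKk : ∀ k : ℕ, ∀ u : ℝ, 2 * (R + 1) < |u| →
      weilConv (weilConv f (moll k)) (weilReflect (weilConv f (moll k))) u = 0 := fun k u hu ↦
    weilConv_weilReflect_eq_zero_of_radius (hfk k) hu
  rw [weilPrimeTerm_eq_sum_of_support hK]
  simp_rw [weilPrimeTerm_eq_sum_of_support (hKk _)]
  refine tendsto_finsetSum _ fun n _ ↦ ?_
  exact ((tendsto_weilConv_weilReflect_moll hfc hfs _).add
    (tendsto_weilConv_weilReflect_moll hfc hfs _)).const_mul _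

/-- **E6, norm form.** Eventually in `k`, `‖weilPrimeTerm ((f⋆moll_k) ⋆ (f⋆moll_k)~)‖ < ‖weilPrimeTerm (f ⋆ f̃)‖ + e`.
[folklore; TIER2-SOUNDNESS-PLAN §2 E6] -/
theorem eventually_norm_weilPrimeTerm_autocorr_moll_lt (hfc : Continuous f) (hfs : HasCompactSupport f) {e : ℝ}
    (he : 0 < e) :
    ∀ᶠ k : ℕ in atTop, ‖weilPrimeTerm (weilConv (weilConv f (moll k)) (weilReflect (weilConv f (moll k))))‖ <
      ‖weilPrimeTerm (weilConv f (weilReflect f))‖ + e :=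
  (tendsto_weilPrimeTerm_autocorr_moll hfc hfs).norm.eventually_lt_const (lt_add_of_pos_right _ he)

/-! ## §3 E7: the generic level-`k` Step 5′ -/

/-- Mollification by the even kernel `moll k` preserves oddness. [folklore] -/
theorem weilConv_moll_neg_of_odd (hodd : ∀ t, f (-t) = -f t) (k : ℕ) (t : ℝ) :
    weilConv f (moll k) (-t) = -weilConv f (moll k) t := by
  rw [← weilConv_comp_neg_moll f k t]
  have e : (fun u : ℝ ↦ f (-u)) = fun u ↦ -f u := funext hodd
  rw [e, weilConv_apply, weilConv_apply, ← integral_neg]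
  refine integral_congr_ae (Eventually.of_forall fun u ↦ ?_)
  simp only [neg_mul]

/-- **E7 — GENERIC LEVEL-`k` STEP 5′.** Let `f ∈ C¹_c` be odd with `∫‖f‖² ≤ A′`, `∫‖f′‖² ≤ B′`, `0 < t₀ ≤ 1`, `e > 0`. Then
eventually in `k`:
`Re Q(f ⋆ moll_k) ≤ ‖weilPrimeTerm (f ⋆ f̃)‖ + e + (B′/2·e^{t₀/2}·t₀²/2 + A′·max 0 (2·Jexplicit t₀ − log 4π − γ − archC₁))`.
Polar `≤ 0` (odd, D5), arch by D7 in the checker's currency with the mollifier's `L²` contractions, prime by E6. The tier-2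
assembly applies this to `f = P.TROdd R` and bounds `‖weilPrimeTerm (f ⋆ f̃)‖` ONCE by the cellwise D6′ of
`WeilColumnThetaPrimeSideT2`. [TIER2-SOUNDNESS-PLAN §2 E7; THETA-CERT-cc6 §D5–D7] -/
theorem eventually_re_weilQuadratic_moll_le (hf1 : ContDiff ℝ 1 f) (hfs : HasCompactSupport f)
    (hodd : ∀ t, f (-t) = -f t) {A' B' t₀ : ℝ} (hA : ∫ x, ‖f x‖ ^ 2 ≤ A') (hB : ∫ x, ‖deriv f x‖ ^ 2 ≤ B')
    (ht₀ : 0 < t₀) (ht₁ : t₀ ≤ 1) {e : ℝ} (he : 0 < e) :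
    ∀ᶠ k : ℕ in atTop, (weilQuadratic (weilConv f (moll k))).re ≤
      ‖weilPrimeTerm (weilConv f (weilReflect f))‖ + e +
        (B' / 2 * Real.exp (t₀ / 2) * t₀ ^ 2 / 2 +
          A' * max 0 (2 * Jexplicit t₀ - Real.log (4 * π) - Real.eulerMascheroniConstant - archC₁)) := by
  have hfc : Continuous f := hf1.continuous
  filter_upwards [eventually_norm_weilPrimeTerm_autocorr_moll_lt hfc hfs he] with k hk
  set g : ℝ → ℂ := weilConv f (moll k) with hgdef
  have hgt : IsWeilTest g := isWeilTest_weilConv_moll hfc hfs k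
  have hoddg : ∀ t, g (-t) = -g t := fun t ↦ weilConv_moll_neg_of_odd hodd k t
  have hD5 : (weilPolarTerm (weilConv g (weilReflect g))).re ≤ 0 := by
    rw [re_weilPolarTerm_weilConv_weilReflect_of_odd hgt hoddg]
    nlinarith [norm_nonneg (weilMellin g 0)]
  have hA' : ∫ x, ‖g x‖ ^ 2 ≤ A' := (integral_norm_sq_weilConv_moll_le hfc hfs k).trans hA
  have hB' : ∫ x, ‖deriv g x‖ ^ 2 ≤ B' := (integral_norm_sq_deriv_weilConv_moll_le hf1 hfs k).trans hB
  have hD7' := ThetaArch.re_weilArchTerm_weilConv_weilReflect_le_thetaCheck hgt hA' hB' ht₀ ht₁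
  have key : ∀ J L γ C : ℝ, 2 * J - (L + γ) - C = 2 * J - L - γ - C := fun _ _ _ _ ↦ by ring
  rw [key] at hD7'
  have hD7 : (weilArchTerm (weilConv g (weilReflect g))).re ≤ B' / 2 * Real.exp (t₀ / 2) * t₀ ^ 2 / 2 +
      A' * max 0 (2 * Jexplicit t₀ - Real.log (4 * π) - Real.eulerMascheroniConstant - archC₁) := by
    refine hD7'.trans (le_of_eq ?_)
    unfold Jexplicit archC₁
    ring
  have hre : (weilQuadratic g).re = (weilPolarTerm (weilConv g (weilReflect g))).re -
      (weilPrimeTerm (weilConv g (weilReflect g))).re + (weilArchTerm (weilConv g (weilReflect g))).re := by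
    simp [weilQuadratic, weilFunctional]
  have hP6 : -(weilPrimeTerm (weilConv g (weilReflect g))).re ≤ ‖weilPrimeTerm (weilConv g (weilReflect g))‖ :=
    (neg_le_abs _).trans (Complex.abs_re_le_norm _)
  rw [hre]
  linarith

/-! ## §4 The order-of-limits combinator of the tier-2 assembly -/

/-- **`R` first, then `k`.** If for every `R ≥ R₀` and every `e > 0`, eventually in `k`, `Q k ≤ L₁ + e + G R + β R`, and
`G R → L₂`, `β R → 0` as `R → ∞`, then for every `e > 0`, eventually in `k`, `Q k ≤ L₁ + L₂ + e`. (Tier 1's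
`eventually_re_weilQuadratic_phi_le_of_steps` has the quantifiers the other way round because its level-`k` constant is
uniform in `R`; with E6 the prime term is controlled per `R`.) [folklore] -/
theorem eventually_le_of_R_steps {Q : ℕ → ℝ} {G β : ℝ → ℝ} {L₁ L₂ R₀ : ℝ}
    (hsteps : ∀ R : ℝ, R₀ ≤ R → ∀ e : ℝ, 0 < e → ∀ᶠ k : ℕ in atTop, Q k ≤ L₁ + e + G R + β R)
    (hG : Tendsto G atTop (𝓝 L₂)) (hβ : Tendsto β atTop (𝓝 0)) {e : ℝ} (he : 0 < e) :
    ∀ᶠ k : ℕ in atTop, Q k ≤ L₁ + L₂ + e := by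
  have h1 : ∀ᶠ R : ℝ in atTop, G R < L₂ + e / 3 := hG.eventually_lt_const (by linarith)
  have h2 : ∀ᶠ R : ℝ in atTop, β R < e / 3 := hβ.eventually_lt_const (by linarith)
  obtain ⟨R, hR₀, hGR, hβR⟩ := ((eventually_ge_atTop R₀).and (h1.and h2)).exists
  filter_upwards [hsteps R hR₀ (e / 3) (by linarith)] with k hk
  linarith

end Summit.RiemannHypothesis.RiemannHypothesis.Theorems.WeilColumn.ThetaMellin

end
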